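import Literature.NumberTheory.EllipticCurves.KrizLi2019.TwoPartBSDTwists
import Literature.NumberTheory.EllipticCurves.Zhai2021.TwoAdicLowerBoundTwists
import HarnessLib

/-!
# Kriz–Li 2019 (FMS 7, e15), §6 Table 1 («Assumption (★) for rank one curves») — the two rank-one rows of conductor `189 = 3³·7` (additive at `3`, GOOD at
# `2`, `c₂(E) = 1`): `189a1 | −47 | 1 | ✓` and `189b1 | −47 | 1 | ✓` AS PRINTED (statement-only named facts; the per-curve inputs of Thm 5.1 (2) =
# `thm112_bsdTwo_twist`)

HONEST FRAMING (cell `bsd-f1-sign2`, seat `bsd-line-gk2-p2` g34, crux U₂ `MinimalTwinBSDTwo` stmt-BirchSwinnertonDyer-22985, LINE 23 «twin_swap»;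
2026-08-31): two PUBLISHED per-curve computational assertions (check-marks in a table of a refereed paper) vendored as named `Prop`s — nothing asserted,
nothing discharged (D-0014) — with a locator into the held source; same shape as `table1_row92b1` / `table1_row37a1` / `table1_row123a1` (optimal
parametrisation datum transcribed because Example 6.2 searches «rank one OPTIMAL elliptic curves»; both curves are GOOD at `2`, so consumers of Thm 5.1 (2)
may ignore the optimality conjunct).  Models = Cremona's reduced minimal models as recorded in the tree's kit census
`Literature/…/HypothesisSweep/RecordsN000178to000233.lean` (`189a1 = [0,0,1,−3,0]`, `189b1 = [0,0,1,−24,45]`).  Consumers (this seat):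
`…KrizLiAnchor189a1/189b1.lean` (Kodaira `IV` resp. `II` at `3` by Step2Cert certificates, `d_K = −47`).  Nothing is booked here; BSD is not proved by any
of this.

Source. D. Kriz, C. Li, *Goldfeld's conjecture and congruences between Heegner points*, Forum Math. Sigma **7** (2019), e15, doi:10.1017/fms.2019.9
[KrizLi2019] = arXiv:1606.03172 (§§1–6). Texts read: the held chunk text `paper:doi-10-1017-fms-2019-9` (p0017 L21: Example 6.2), which DROPS the table body;
the table itself was read in the arXiv v3 source `Congruence.tex` (copy at `run/shared/lean/pub/bsd-print-cf2/lit/krizli2019/arXiv-1606.03172v3-Congruence.tex`),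
ll. 964–1017 (`\label{{tab:1}}`, Example 6.2), rows at lines 996 (`189a1 & -47 & 1 & \checkmark`) and 997 (`189b1 & -47 & 1 & \checkmark`).

## The printed statement (verbatim)

* Example 6.2 (tex l. 965): "We search for rank one optimal elliptic curves with `E(ℚ)[2] = 0` satisfying these two necessary conditions. … For each curve,
  we choose `K` with smallest `|d_K|` satisfying the Heegner hypothesis for `N` and such that `2` is split in `K`. Then 31 out of 38 curves satisfy (★).
  See Table 1. … If `c₂(E)` is further odd (true for 23 out of 31), then the application to BSD(2) (Theorem 5.1) also applies."
* Table 1, caption "Assumption (★) for rank one curves", header `E | d_K | c₂(E) | ★`, the rows transcribed here: "`189a1 & -47 & 1 & ✓`",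
  "`189b1 & -47 & 1 & ✓`".

## Transcription (tree dictionary of `KrizLi2019/TwoPartBSDTwists.lean`)

"`K = ℚ(√−47)`" = any `K` with `IsImaginaryQuadratic K` and `NumberField.discr K = −47`.  "Optimal curve with its parametrisation" = a datum
`Dt : ModularParametrizationData E N` at the conductor level (`NeZero` witness packed) with `Zhai2021.IsOptimalDatum E Dt`; "(★) holds" = a Heegner datum `H`,
an embedding `ι`, a point `P ∈ E(K)` mapping to `heegnerPointComplex Dt H`, and `j : K →ₐ[ℚ] ℚ₂` with `AssumptionStar E Dt K P j`.  Global minimality of the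
printed model is a binder `[IsGloballyMinimal]`.  "Rank one", "`E(ℚ)[2] = 0`", "`c₂(E) = 1`" are NOT transcribed (kernel-side in the consumer).  Nothing
weaker or stronger is transcribed; no `_holds` is expected.  Status: PUB (refereed); per-curve computational TABLE entries, flag word for the referee: TABLE.

## References
* [KrizLi2019] §6 Example 6.2 and Table 1 (FMS chunk p0017 L21; arXiv:1606.03172v3 `Congruence.tex` ll. 965, 996, 997); Assumption (★) (arXiv p0003 L45–L48).
* [CremonaAlgorithms1997] Table 1 (curves 189A1, 189B1).
* [Zhai2021BSDExactFormulaTwists] §1 (the optimality predicate `IsOptimalDatum`).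
-/

noncomputable section

open scoped Classical

open NumberField WeierstrassCurve Literature.NumberTheory.EllipticCurves
  Literature.NumberTheory.EllipticCurves.ModularForms

namespace Literature.NumberTheory.EllipticCurves.KrizLi2019

/-- **Kriz–Li 2019, §6 Table 1, row `189a1`** (`189a1 | d_K = -47 | c₂(E) = 1 | ★ ✓`; Example 6.2): for every imaginary quadratic field `K` of discriminant
`-47`, the optimal curve `189a1` on its (globally minimal) model `[0,0,1,-3,0]` (`y² + y = x³ − 3x`; `Δ = 3⁵·7`, `N = 3³·7`) admits an OPTIMAL modular
parametrisation datum `Dt` at level `N(E)`, a Heegner datum `H` of discriminant `d_K` and level `N(E)`, an embedding `ι : K → ℂ`, a point `P ∈ E(K)` mapping to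
`heegnerPointComplex Dt H`, and `j : K → ℚ₂` with `AssumptionStar E Dt K P j`.  Statement only; TABLE entry; no `_holds` expected.
[cite: KrizLi2019, §6 Table 1 (row 189a1) and Example 6.2 (FMS 7 (2019) e15, chunk p0017 L21; arXiv:1606.03172v3 Congruence.tex ll. 965, 996)] -/
def table1_row189a1 : Prop :=
  ∀ [(⟨0, 0, 1, -3, 0⟩ : WeierstrassCurve ℚ).IsGloballyMinimal]
    (K : Type) [Field K] [NumberField K], IsImaginaryQuadratic K → NumberField.discr K = -47 →
    ∃ (_ : NeZero ((⟨0, 0, 1, -3, 0⟩ : WeierstrassCurve ℚ).conductorNorm ℤ))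
      (Dt : ModularParametrizationData (⟨0, 0, 1, -3, 0⟩ : WeierstrassCurve ℚ) ((⟨0, 0, 1, -3, 0⟩ : WeierstrassCurve ℚ).conductorNorm ℤ))
      (H : HeegnerDatum ((⟨0, 0, 1, -3, 0⟩ : WeierstrassCurve ℚ).conductorNorm ℤ) (NumberField.discr K))
      (ι : K →+* ℂ) (P : ((⟨0, 0, 1, -3, 0⟩ : WeierstrassCurve ℚ).baseChange K).toAffine.Point) (j : K →ₐ[ℚ] ℚ_[2]),
      Zhai2021.IsOptimalDatum (⟨0, 0, 1, -3, 0⟩ : WeierstrassCurve ℚ) Dt ∧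
        WeierstrassCurve.Affine.Point.map ι.toRatAlgHom P = heegnerPointComplex Dt H ∧
          AssumptionStar (⟨0, 0, 1, -3, 0⟩ : WeierstrassCurve ℚ) Dt K P j

/-- **Kriz–Li 2019, §6 Table 1, row `189b1`** (`189b1 | d_K = -47 | c₂(E) = 1 | ★ ✓`; Example 6.2): for every imaginary quadratic field `K` of discriminant
`-47`, the optimal curve `189b1` on its (globally minimal) model `[0,0,1,-24,45]` (`y² + y = x³ − 24x + 45`; `Δ = 3³·7`, `N = 3³·7`) admits an OPTIMAL modular
parametrisation datum `Dt` at level `N(E)`, a Heegner datum `H` of discriminant `d_K` and level `N(E)`, an embedding `ι : K → ℂ`, a point `P ∈ E(K)` mapping to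
`heegnerPointComplex Dt H`, and `j : K → ℚ₂` with `AssumptionStar E Dt K P j`.  Statement only; TABLE entry; no `_holds` expected.
[cite: KrizLi2019, §6 Table 1 (row 189b1) and Example 6.2 (FMS 7 (2019) e15, chunk p0017 L21; arXiv:1606.03172v3 Congruence.tex ll. 965, 997)] -/
def table1_row189b1 : Prop :=
  ∀ [(⟨0, 0, 1, -24, 45⟩ : WeierstrassCurve ℚ).IsGloballyMinimal]
    (K : Type) [Field K] [NumberField K], IsImaginaryQuadratic K → NumberField.discr K = -47 →
    ∃ (_ : NeZero ((⟨0, 0, 1, -24, 45⟩ : WeierstrassCurve ℚ).conductorNorm ℤ))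
      (Dt : ModularParametrizationData (⟨0, 0, 1, -24, 45⟩ : WeierstrassCurve ℚ) ((⟨0, 0, 1, -24, 45⟩ : WeierstrassCurve ℚ).conductorNorm ℤ))
      (H : HeegnerDatum ((⟨0, 0, 1, -24, 45⟩ : WeierstrassCurve ℚ).conductorNorm ℤ) (NumberField.discr K))
      (ι : K →+* ℂ) (P : ((⟨0, 0, 1, -24, 45⟩ : WeierstrassCurve ℚ).baseChange K).toAffine.Point) (j : K →ₐ[ℚ] ℚ_[2]),
      Zhai2021.IsOptimalDatum (⟨0, 0, 1, -24, 45⟩ : WeierstrassCurve ℚ) Dt ∧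
        WeierstrassCurve.Affine.Point.map ι.toRatAlgHom P = heegnerPointComplex Dt H ∧
          AssumptionStar (⟨0, 0, 1, -24, 45⟩ : WeierstrassCurve ℚ) Dt K P j

end Literature.NumberTheory.EllipticCurves.KrizLi2019

end
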